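import Summits.AtomisticToContinuum.BoseEinsteinCondensation.Theorems.BECCutLineWeakDisorderDefs
import Literature.MathematicalPhysics.QuantumManyBody.GroundStateFeynmanKacHeatKernel
import HarnessLib

/-!
# Route `BECCutLineWeakDisorder`, crux `TwoReplicaTransienceBound` (stmt-AtomisticToContinuum-9687):
# the free sandwich of the passive tracer (line `SketchIdeator1`, tracer decoupling — toolbox)

Elementary comparison of the passive-tracer survival functional `tracer v L T x Y ωb`
(`Theorems/BECCutLineWeakDisorderDefs.lean`) with the FREE tracer `tracer 0 L T x Y ωb` (no tagged–bath
interaction: the Dirichlet survival probability of one Brownian line from `x`, independent of the bath):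

* `taggedBathAction_mono`, `tracer_antitone` — more repulsion, less survival: `v ≤ v' ⇒ tracer v' ≤ tracer v`;
  in particular `tracer v ≤ tracer 0` (`tracer_le_free`);
* `taggedBathAction_le_of_le` — for a bounded potential `v ≤ C` the tagged–bath action on `[0, T]` is at
  most `n · C · T`, whence the lower bound `e^{-nCT} · tracer 0 ≤ tracer v` (`expNeg_mul_free_le_tracer`);
* `tracer_free_eq` — the free tracer does not depend on the bath data `(Y, ωb)`;
* `stub_tracerSandwich` (registered toolbox stub) — the pathwise consequence for the quenched participation
  ratio of the tracer profile: `∫ₓ g² / (∫ₓ g)² ≤ ∫ₓ θ² / (e^{-nCT} ∫ₓ θ)²`, `g = tracer v`, `θ = tracer 0`,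
  for EVERY bath path — the short-time (`T ≲ L²`) half of the per-box boundedness of the line's quenched
  engine `TracerProfileBound` for bounded `v` (crux workfile `EngineDossier.md` §2c; the late-time half is the
  mixture inequality of `…TwoReplicaTransienceBoundMixture.lean`).

Reference: K. L. Chung, Z. Zhao, *From Brownian Motion to Schrödinger's Equation* (1995), §3.2 (monotonicity
of Feynman–Kac functionals in the potential).
-/

noncomputable section

namespace Summit.AtomisticToContinuum.BoseEinsteinCondensation.Cruxes.TwoReplicaTransienceBound.TracerDecoupling

open MeasureTheory Filter Set
open scoped ENNReal NNReal Topology BigOperators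
open Literature.MathematicalPhysics.QuantumManyBody.BoseGas

variable {n : ℕ}

/-- The tagged–bath action is monotone in the pair potential. -/
theorem taggedBathAction_mono {v v' : ℝ → ℝ≥0∞} (h : ∀ r, v r ≤ v' r) (T : ℝ) (x : Space)
    (Y : Config n) (ω₀ : Fin 3 → (ℝ≥0 → ℝ)) (ωb : PathSpace n) :
    taggedBathAction v T x Y ω₀ ωb ≤ taggedBathAction v' T x Y ω₀ ωb :=
  lintegral_mono fun _ => Finset.sum_le_sum fun _ _ => h _

/-- For a constant potential `C` the tagged–bath action on `[0, T]` is `n · C · T`. -/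
theorem taggedBathAction_const (C : ℝ≥0∞) (T : ℝ) (x : Space) (Y : Config n)
    (ω₀ : Fin 3 → (ℝ≥0 → ℝ)) (ωb : PathSpace n) :
    taggedBathAction (fun _ => C) T x Y ω₀ ωb = (n : ℝ≥0∞) * C * ENNReal.ofReal T := by
  simp only [taggedBathAction, Finset.sum_const, Finset.card_univ, Fintype.card_fin, nsmul_eq_mul,
    setLIntegral_const, Real.volume_Ioc, sub_zero]

/-- The free tagged–bath action vanishes. -/
theorem taggedBathAction_zero (T : ℝ) (x : Space) (Y : Config n) (ω₀ : Fin 3 → (ℝ≥0 → ℝ))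
    (ωb : PathSpace n) : taggedBathAction (fun _ => 0) T x Y ω₀ ωb = 0 := by
  rw [taggedBathAction_const]; simp

/-- For a bounded potential `v ≤ C`, the tagged–bath action on `[0, T]` is at most `n · C · T`. -/
theorem taggedBathAction_le_of_le {v : ℝ → ℝ≥0∞} {C : ℝ≥0∞} (hC : ∀ r, v r ≤ C) (T : ℝ) (x : Space)
    (Y : Config n) (ω₀ : Fin 3 → (ℝ≥0 → ℝ)) (ωb : PathSpace n) :
    taggedBathAction v T x Y ω₀ ωb ≤ (n : ℝ≥0∞) * C * ENNReal.ofReal T :=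
  (taggedBathAction_mono hC T x Y ω₀ ωb).trans (taggedBathAction_const C T x Y ω₀ ωb).le

/-- **More repulsion, less survival**: the tracer functional is antitone in the pair potential. -/
theorem tracer_antitone {v v' : ℝ → ℝ≥0∞} (h : ∀ r, v r ≤ v' r) (L T : ℝ) (x : Space) (Y : Config n)
    (ωb : PathSpace n) : tracer v' L T x Y ωb ≤ tracer v L T x Y ωb :=
  lintegral_mono fun ω₀ => mul_le_mul' le_rfl (expNeg_antitone (taggedBathAction_mono h T x Y ω₀ ωb))

/-- The tracer is dominated by the free tracer (drop the tagged–bath repulsion). -/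
theorem tracer_le_free (v : ℝ → ℝ≥0∞) (L T : ℝ) (x : Space) (Y : Config n) (ωb : PathSpace n) :
    tracer v L T x Y ωb ≤ tracer (fun _ => 0) L T x Y ωb :=
  tracer_antitone (fun _ => bot_le) L T x Y ωb

/-- The free tracer is the Dirichlet survival probability of one Brownian line from `x` on `[0, T]`; it does
not depend on the bath data `(Y, ωb)`. -/
theorem tracer_free_eq (L T : ℝ) (x : Space) (Y Y' : Config n) (ωb ωb' : PathSpace n) :
    tracer (fun _ => 0) L T x Y ωb = tracer (fun _ => 0) L T x Y' ωb' := by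
  simp only [tracer, taggedBathAction_zero, expNeg_zero, mul_one]

/-- **Lower sandwich** for a bounded potential `v ≤ C`: `e^{-nCT} · tracer 0 ≤ tracer v` (on the tagged
survival event the tagged–bath action is at most `nCT`). -/
theorem expNeg_mul_free_le_tracer {v : ℝ → ℝ≥0∞} {C : ℝ≥0∞} (hC : ∀ r, v r ≤ C) (L T : ℝ) (x : Space)
    (Y : Config n) (ωb : PathSpace n) :
    expNeg ((n : ℝ≥0∞) * C * ENNReal.ofReal T) * tracer (fun _ => 0) L T x Y ωb ≤ tracer v L T x Y ωb := by
  rw [tracer, tracer, ← lintegral_const_mul' _ _ (ne_top_of_le_ne_top ENNReal.one_ne_top (expNeg_le_one _))]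
  refine lintegral_mono fun ω₀ => ?_
  rw [taggedBathAction_zero, expNeg_zero, mul_one, mul_comm]
  exact mul_le_mul' le_rfl (expNeg_antitone (taggedBathAction_le_of_le hC T x Y ω₀ ωb))

/-- **Registered toolbox stub `stub_tracerSandwich`**: pathwise comparison of the quenched participation ratio
of the tracer profile with the free one, for a bounded pair potential `v ≤ C` — for every slice `Y` and EVERY
bath path `ωb`, `∫ₓ g²/(∫ₓ g)² ≤ ∫ₓ θ²/(e^{-nCT}∫ₓ θ)²` with `g = tracer v`, `θ = tracer 0` (`[0,∞]`
conventions). -/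
theorem stub_tracerSandwich :
    ∀ (n : ℕ) (v : ℝ → ENNReal) (C : ENNReal), (∀ r, v r ≤ C) → ∀ (L T : ℝ) (Y : Config n)
      (ωb : PathSpace n), (∫⁻ x, tracer v L T x Y ωb ^ 2) / (∫⁻ x, tracer v L T x Y ωb) ^ 2 ≤
        (∫⁻ x, tracer (fun _ => 0) L T x Y ωb ^ 2) /
          (expNeg (n * C * ENNReal.ofReal T) * ∫⁻ x, tracer (fun _ => 0) L T x Y ωb) ^ 2 := by
  intro n v C hC L T Y ωb
  refine ENNReal.div_le_div (lintegral_mono fun x => ?_) ?_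
  · exact pow_le_pow_left' (tracer_le_free v L T x Y ωb) 2
  · refine pow_le_pow_left' ?_ 2
    rw [← lintegral_const_mul' _ _ (ne_top_of_le_ne_top ENNReal.one_ne_top (expNeg_le_one _))]
    exact lintegral_mono fun x => expNeg_mul_free_le_tracer hC L T x Y ωb

end Summit.AtomisticToContinuum.BoseEinsteinCondensation.Cruxes.TwoReplicaTransienceBound.TracerDecoupling

end
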